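import Literature.MathematicalPhysics.QuantumFieldTheory.Balaban1983to89.B9Cor36GDirKnitRightEntryAtCutField
import Literature.MathematicalPhysics.QuantumFieldTheory.Balaban1983to89.B9Cor36GDirKnitRowsAtMemberY
import Literature.MathematicalPhysics.QuantumFieldTheory.Balaban1983to89.B9CubeDirInverseBondCRowsNamedY

/-!
# `Balaban1983to89.B9Cor36GDirKnitRowsAtMemberRY` — [Balaban1985BackgroundPropagators] COROLLARY 3.6 p. 408 ∕ THEOREM 3.3 (3.42) FOR THE DIRICHLET BOND LETTER OF
# RECORD `G_□(U) = GDirCKY i □ (DP_□D*) (bondsOverY Ω₀(□)) U` AT EVERY MEMBER OF THE RECORD, EVERY UNITARY-VALUED `U` AND EVERY COVER CUBE: dag-n06-d's bundle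
# `CubeRowsGDirCY x.toKIdx □ U dB B δ (9∕5000)` — ALL FOUR entries (3.42)₀₋₃ incl. the RIGHT one `G_□(Ṽ)∇*_{Ṽ,ν}` — from the bond datum, the socket and ONE named
# fact `h26R` (= F6 ✓`cubeRowsGDirCY_at_memberU` with its displayed flat right half `hR` DISCHARGED by R4 ✓`gDir_knit_rightFlat_at_cutFieldU`), plus the hypothesis
# pack `GDirPackRY`, the universal block `RowsBodyRY` and the NAMED constants `gdirRδ ∕ gdirRB ∕ gdirRM₀ ∕ gdirRT₀ ∕ gdirRN₀ ∕ gdirRdB ∕ gdirRa₁` in dag-n06-d's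
# ✓`B9CubeDirInverseBondCRowsNamedY` format — seat dag-n06-c g36, FILE R5 of «E2 BY NAME» (cell GAPS G-B9-02 at the Dirichlet bond letter of record: closed modulo
# [4] Prop. 2.6 for `G(Ω)` by name)

statement-level skeleton of published theorems with citation tags; proofs where landed; nothing here is a claim about the Yang–Mills mass gap

CITATION HEADER (lean-in-tree rule).  B9 = T. Bałaban, *Propagators for lattice gauge theories in a background field*, Commun. Math. Phys. **99** (1985)
389–434 [Balaban1985BackgroundPropagators] (held `paper:balaban1985-cmp99-background-propagators`; journal page = PDF page + 388): Cor. 3.6 p. 408 l. 1–14; Thm 3.1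
(3.42) p. 397 (all four entries); Thm 3.3 p. 399; (3.86) p. 407 («This way we get all these inequalities for the operator G(U′U)»); p. 398 l. 20–24; (3.35) p. 396;
p. 409 l. 1–5 («G_□(U)»); p. 410 l. 14–15 («all the results of these theorems are gauge invariant»).  [4] = [Balaban1984PropagatorsII] Prop. 2.6 (2.136) p. 247,
p. 248 l. 4–5, Lemma 2.1 (2.61) p. 234, (2.51) p. 232.  Rows B9.Cor3.6 × B9.Thm3.3 × B9.Eq3.42 × B6.Prop2.6 (cells only; no row head changes).

WHY THIS FILE (cell `pub-ymgap`, node N06 [B9]; road (B5)).  The heads of record «KE₂₁X-C» ✓p836416 ∕ «KESC-CO» ✓p836424 display for the bond letter of record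
(via ✓`cubeRowsGDirCY_named`): `h26` (named fact), `hKBA` (socket; ✓`exists_bondSocket`), `hDatBu` (LOCATED-32), `hRflA` (flat right half at an x-free `BA₂`; GAPS
G-B9-02) + thresholds + numerics.  With R1–R4 the flat right half is a theorem modulo `h26R`; THIS FILE re-presses F6's bundle WITHOUT `hR`∕`B₂`: §1
★★★`cubeRowsGDirCY_at_memberR` (F6's proof with F5's E2 clause fed by R4, rates joined at `δ = min(δ_F5, ρ_R)`); §2 `GDirPackRY` (= ✓`GDirPackY` with
`GDirBFam ↦ GDirBFamR`), `gdirPackY_of_packR` (the old pack follows: R1 ✓`prop26Dirichlet_of_right`), `RowsBodyRY` (= ✓`RowsBodyY` without the `B₂`∕`hR` binders),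
`rowsBodyRY_of_packR`; §3 the seven named constants `gdirR*`, `gdirR_rows_of_packR`, sign facts, ★`cubeRowsGDirCY_namedR` (heads' binder order: socket, bond datum at
`gdirRa₁`, pack; conclusion `CubeRowsGDirCY x.toKIdx □ U gdirRdB gdirRB gdirRδ (9∕5000)`) — so the heads can key `GDirPackRY` and drop `hRflA`, `BA₂`, `hBA₂`.

WHAT IS PROVED (9 `def`s with bodies — `GDirPackRY`, `RowsBodyRY` (Props with parameters, hypothesis packs — NOT named facts), `gdirRδ`, `gdirRB`, `gdirRM₀`, `gdirRT₀`,
`gdirRN₀`, `gdirRdB`, `gdirRa₁`; theorems; 0 sorry; 0 new named facts; standard axioms): §1 ★★★`cubeRowsGDirCY_at_memberR`; §2 `gdirPackY_of_packR`, `rowsBodyRY_of_packR`;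
§3 `gdirR_rows_of_packR`, `gdirRδ_pos`, `gdirRB_nonneg`, `gdirRa₁_pos`, ★`cubeRowsGDirCY_namedR`.

HONEST SCOPE ∕ NOT CLAIMED.  Re-keying by name over landed theorems (F5, F6's `cubeRowsGDirCY_of_cutDatum` road, R4); CONDITIONAL BY NAME on [4] Prop. 2.6 for `G(Ω)`
read with its third entry (`h26R`; the named printed assertion, NOT proved); still DISPLAYED: the bond socket (inhabited by ✓`exists_bondSocket`), the (3.35) bond datum
`DatumBUY` (LOCATED-32), the x-free knit-engine numerics, member thresholds.  Nothing on `d = 4`, the continuum, reflection positivity or the mass gap; NOT a node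
discharge; count-neutral; no row head changes.  NEW file; nothing landed is modified (F6 and ✓`B9CubeDirInverseBondCRowsNamedY` untouched).  `--supports stmt-QuantumFields-27239`.

RELATED IN THE TREE, NOT DUPLICATED (searched 2026-08-31: `rg 'cubeRowsGDirCY_at_memberR|GDirPackRY|RowsBodyRY|gdirRδ|cubeRowsGDirCY_namedR'` over `Literature/` + `Summits/` = ∅):
F6 ✓`B9Cor36GDirKnitRowsAtMemberY` (with `hR`; `DatumBWit`∕`DatumBUY` USED), dag-n06-d ✓`B9CubeDirInverseBondCRowsNamedY` (the named edition with `hR`; format copied),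
✓`B9CubeDirInverseBondCMemberRowsAtRecordY` (`CubeRowsGDirCY`, `cubeRowsGDirCY_of_cutDatum`; USED), F5, R4 (USED).
-/

noncomputable section

namespace Literature.MathematicalPhysics.QuantumFieldTheory.Balaban1983to89.B9Cor36GDirKnitRowsAtMemberRY

open B6RandomWalk (HasMajorant hasMajorant_mono Ineq261)
open B9Thm34Ext (toB6)
open B9Eq352DivFormLetters (conj)
open B9Eq39Adjoint (fluct covD)
open B6KLevelCensusIndexV1 (KIdx kGeo)
open B6Cover236MultiLevelBlocks (cubes)
open B6GlobalChartV1 (PV boxEquiv)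
open B9BackgroundsKLevelV1 (shiftsV1)
open B9Eq360DeltaPrimeAY (AfldY)
open B9Eq337CutFieldDirY (cutCfgS)
open B9CubeLettersOpsL0 (levCubeY)
open B9CubeLettersBondOpsL0 (BlkCubeY)
open B9CubeGeometryInputs (geoCK geoCK_len_pos geoCK_dist_axioms RM1 N1 exists_h261_geoCK)
open B9Cor35GCubeInputsAtOne (blkBK)
open B9Cor35GpAtCubeLetters (hasMajorant_weaken)
open B9Cor35GpDirInputsAtOne (dirDomY)
open B9Cor35GDirInputsAtOne (GiK mDirC geoDirBI domDirBI admDirBI GDirBFam)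
open B9Cor35GDirKnitInputsAtOne (TKnitCY)
open B9Cor36GpDirMemberBlocksAtRecordY (collarS2Y)
open B9Cor36GDirCutWindows (unitaryLike_cutCfgS_of_unitary)
open B9Cor36GDirKnitEntriesAtCutField (gDir_knit_entries_at_cutFieldU)
open B9CubeDirInverseBondCMemberRowsAtRecordY (CubeRowsGDirCY cubeRowsGDirCY_of_cutDatum)
open B9Cor36GDirKnitRowsAtMemberY (DatumBWit DatumBUY)
open B9Prop26DirichletBondReadingRight (GDirBFamR prop26Dirichlet_of_right)
open B9Cor36GDirKnitRightEntryAtCutField (gDir_knit_rightFlat_at_cutFieldU)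
open B9Cor35CinvAtCubeLetters (kernel_rate_mono)
open B9BondReadDomainsPinY (nearAPinCY)
open B9PinMembersKLevelV1 (MemberY)
open B9Thm39ReadingCoords (coordBound39 abs_repr_le)
open B9CoReadingCoordsTranspose (TrIdx trBasis)
open B9CoReadingCoords (cdsBₗ)
open B9C2FormBoxRegimeY (Kpl)
open B7Prop5CplxLevels (epsCplx tauCplx)
open B7Prop2Explicit (unitaryUnits C0 c2')
open B7Prop3Flat (c3)
open Node00 (SiteY FBondY CfgY GaugeY toKT shiftY gaugeY)
open Node00.OpsYCubeDirInverseBond (bondsOverY)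
open scoped Matrix Matrix.Norms.L2Operator

variable {d ℓ : ℕ} {hd : 1 ≤ d + 1} {hL : Odd (ℓ + 1) ∧ 1 < ℓ + 1} {b₀ b₁ : ℝ} {N : ℕ}

/-! ## §1  ★★★ The bundle at every member, every unitary-valued `U`, every cube — no flat right half displayed -/

section Main

variable [Nonempty (Fin N)] {Mstar : ℕ}

set_option maxHeartbeats 1600000 in
/-- ★★★ **dag-n06-d's BUNDLE `CubeRowsGDirCY` INHABITED AT EVERY `(x, α₀, U, □)` FROM THE BOND DATUM, THE SOCKET AND ONE NAMED FACT** (Cor. 3.6 for the Dirichlet bond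
letter of record; F6 ✓`cubeRowsGDirCY_at_memberU` with the flat right half SUPPLIED by R4): IF `B6.Prop26DirichletPrinted` holds at the right-entry family `GDirBFamR`
(`h26R`, by name) and the x-free knit-engine numerics hold, THEN there are `δ > 0`, `B ≥ 0`, `dB`, thresholds `M₀, T₀, N₀` and `a₁ > 0` (chosen before the member and its
auxiliary `α₀`) such that for every member `x` above the thresholds, every `α₀ > 0` with `K_pl(Mα₀)L⁴ < α₀′`, every unitary-valued `U` with a real inverse of the
compression of `mDirC x.toKIdx □` and a `DatumBUY x.toKIdx □ U a₁ α₀′ ϱ′` at every cover cube `□`: `CubeRowsGDirCY x.toKIdx □ U dB B δ (9∕5000)` at every `□`.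
[cite: Balaban1985BackgroundPropagators, Cor. 3.6 p.408 l.1–14, Cor. 3.5 p.407, Thm 3.3 p.399, Thm 3.1 (3.42) p.397, (3.86) p.407, (3.35) p.396, p.409 l.1–5, p.410 l.14–15; Balaban1984PropagatorsII, Lemma 2.1 (2.61) p.234, (2.51) p.232, Prop. 2.6 (2.136) p.247, p.248 l.4–5] -/
theorem cubeRowsGDirCY_at_memberR
    (h26R : B6.Prop26DirichletPrinted (geoDirBI (d := d) (ℓ := ℓ) (hd := hd) (hL := hL) (b₀ := b₀) (b₁ := b₁)) domDirBI admDirBI GDirBFamR)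
    (hℓ : 1 ≤ ℓ) (hb₀ : 0 < b₀) (hb₁ : b₀ ≤ b₁)
    {α₀' ϱ' ϱ : ℝ} (hα' : 0 < α₀') (hα3 : C0 (d + 1) * α₀' ≤ 1 / 3) (hα8 : 8 * α₀' ≤ c2' (d + 1) (ℓ + 1))
    (hϱ' : 0 < ϱ') (hϱ : 0 < ϱ)
    (hsmall' : Real.exp (4 * (800 * (((d + 1 : ℕ) : ℝ) + 1) ^ 2 * (((d + 1 : ℕ) : ℝ) + 4)) * α₀') * (1 + 8 * (131072 * (((d + 1 : ℕ) : ℝ) + 1) ^ 2) * ϱ') ≤ 2)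
    (hc₃' : 2 * ϱ' ≤ c3 (d + 1) (ℓ + 1)) (hϱ'1 : 409600 * (((d + 1 : ℕ) : ℝ) + 1) ^ 2 * ϱ' ≤ 1)
    (hE : epsCplx (d + 1) (ℓ + 1) ϱ' 0 ≤ 1 / 16)
    (hdX : ((d + 1 : ℕ) : ℝ) * (epsCplx (d + 1) (ℓ + 1) ϱ' 0 + tauCplx (d + 1) (ℓ + 1) α₀' 0 ϱ' 0) ≤ 1 / 16)
    (hsmallJ : Real.exp (4480 * (((d + 1 : ℕ) : ℝ) + 1) ^ 2 * (((d + 1 : ℕ) : ℝ) + 4) * α₀' + 240000 * (((d + 1 : ℕ) : ℝ) + 1) ^ 3 * ϱ') *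
      (1 + 8 * (2097152 * (((d + 1 : ℕ) : ℝ) + 1) ^ 2) * ϱ) ≤ 2)
    (hc₃J : 2 * ϱ ≤ c3 (d + 1) (ℓ + 1) / 4) :
    ∃ δ B M₀ T₀ : ℝ, ∃ N₀ dB : ℕ, 0 < δ ∧ 0 ≤ B ∧ ∃ a₁ : ℝ, 0 < a₁ ∧
    ∀ (x : MemberY d ℓ hd hL b₀ b₁ Mstar),
      M₀ ≤ ((ℓ : ℝ) + 1) * (toKT x.toKIdx).Mh → N₀ + 1 ≤ (toKT x.toKIdx).R * ((ℓ + 1) * (toKT x.toKIdx).Mh) → T₀ ≤ RM1 x.toKIdx →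
    ∀ α₀ : ℝ, 0 < α₀ → 0 ≤ (kGeo x.toKIdx).M * α₀ → Kpl x.toKIdx ((kGeo x.toKIdx).M * α₀) * (kGeo x.toKIdx).L ^ 4 < α₀' →
    ∀ (U : CfgY (Matrix (Fin N) (Fin N) ℂ) x.toKIdx), (∀ μ z, U μ z ∈ unitaryUnits (Matrix (Fin N) (Fin N) ℂ)) →
      (∀ c' : ↥(cubes x.toKIdx.D.toDomains), ∃ KB : Matrix (FBondY x.toKIdx) (FBondY x.toKIdx) ℝ,
        (mDirC x.toKIdx c').submatrix (fun v : ↥(bondsOverY x.toKIdx (dirDomY x.toKIdx c')) => (v : FBondY x.toKIdx))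
            (fun v : ↥(bondsOverY x.toKIdx (dirDomY x.toKIdx c')) => (v : FBondY x.toKIdx)) *
          KB.submatrix (fun v : ↥(bondsOverY x.toKIdx (dirDomY x.toKIdx c')) => (v : FBondY x.toKIdx))
            (fun v : ↥(bondsOverY x.toKIdx (dirDomY x.toKIdx c')) => (v : FBondY x.toKIdx)) = 1) →
      (∀ c' : ↥(cubes x.toKIdx.D.toDomains), DatumBUY x.toKIdx c' U a₁ α₀' ϱ') →
      ∀ c' : ↥(cubes x.toKIdx.D.toDomains), CubeRowsGDirCY x.toKIdx c' U dB B δ (9 / 5000) := by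
  classical
  have hM₂ : 0 ≤ coordBound39 (trBasis N) := norm_nonneg _
  -- F5 (at `h26 := prop26Dirichlet_of_right h26R`): the unit and the covariant entries, E2 modulo its flat half
  obtain ⟨δ, Bf, M₀, T₀, N₀, hδ, hBf, a₁, ha₁, h⟩ := gDir_knit_entries_at_cutFieldU (d := d) (ℓ := ℓ) (hd := hd) (hL := hL) (b₀ := b₀) (b₁ := b₁) (trBasis N)
    (prop26Dirichlet_of_right h26R) hℓ hb₀ hb₁ (coordBound39 (trBasis N)) hM₂ (abs_repr_le (trBasis N)) hα' hα3 hα8 hϱ' hϱ hsmall' hc₃' hϱ'1 hE hdX hsmallJ hc₃J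
  -- R4: the flat half of the right entry
  obtain ⟨ρR, B₂, MR, TR, NR, hρR, hB₂, aR, haR, hRt⟩ := gDir_knit_rightFlat_at_cutFieldU (d := d) (ℓ := ℓ) (hd := hd) (hL := hL) (b₀ := b₀) (b₁ := b₁) (trBasis N)
    h26R hℓ hb₀ hb₁ (coordBound39 (trBasis N)) hM₂ (abs_repr_le (trBasis N)) hα' hα3 hα8 hϱ' hϱ hsmall' hc₃' hϱ'1 hE hdX hsmallJ hc₃J
  -- the joint rate and (2.61) there
  set δ' : ℝ := min δ ρR with hδ'def
  have hδ' : 0 < δ' := lt_min hδ hρR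
  have hδ'δ : δ' ≤ δ := min_le_left _ _
  have hδ'R : δ' ≤ ρR := min_le_right _ _
  obtain ⟨dB, h261⟩ := exists_h261_geoCK d ℓ hδ'
  refine ⟨δ', B₂ + Bf, max M₀ MR, max T₀ TR, max (max N₀ NR) (N1 d ℓ (9 / 5000 * δ')), dB, hδ', by positivity, min a₁ aR, lt_min ha₁ haR, ?_⟩
  intro x hM hN hT α₀ hα₀ hMα hKpl U hUu hKB hDat c'
  have hM₀ : M₀ ≤ ((ℓ : ℝ) + 1) * (toKT x.toKIdx).Mh := (le_max_left _ _).trans hM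
  have hMR : MR ≤ ((ℓ : ℝ) + 1) * (toKT x.toKIdx).Mh := (le_max_right _ _).trans hM
  have hT₀ : T₀ ≤ RM1 x.toKIdx := (le_max_left _ _).trans hT
  have hTR : TR ≤ RM1 x.toKIdx := (le_max_right _ _).trans hT
  have hN₀ : N₀ + 1 ≤ (toKT x.toKIdx).R * ((ℓ + 1) * (toKT x.toKIdx).Mh) := le_trans (Nat.succ_le_succ ((le_max_left _ _).trans (le_max_left _ _))) hN
  have hNR : NR + 1 ≤ (toKT x.toKIdx).R * ((ℓ + 1) * (toKT x.toKIdx).Mh) := le_trans (Nat.succ_le_succ ((le_max_right _ _).trans (le_max_left _ _))) hN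
  have hN₁ : N1 d ℓ (9 / 5000 * δ') + 1 ≤ (toKT x.toKIdx).R * ((ℓ + 1) * (toKT x.toKIdx).Mh) := le_trans (Nat.succ_le_succ (le_max_right _ _)) hN
  obtain ⟨u, A, Q, T, C, ξ, Λ, hW⟩ := hDat c'
  obtain ⟨hu, hC, hξ, hΛ, hΛξ, hTS, hTn, hQT, hgA, hA, hdA, hα₁, hα₁ϱ, hsmall, hc₃, hsm⟩ := hW
  have hα₁f : 2 * C * Λ ^ 2 ≤ a₁ := hα₁.trans (min_le_left _ _)
  have hα₁R : 2 * C * Λ ^ 2 ≤ aR := hα₁.trans (min_le_right _ _)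
  obtain ⟨KB, hKB'⟩ := hKB c'
  have hα4' : 4 * α₀' ≤ c2' (d + 1) (ℓ + 1) := by linarith
  have hU := unitaryLike_cutCfgS_of_unitary x.toKIdx (T := T) (η := (kGeo x.toKIdx).eta) (A := A) hu hUu hQT hgA
  obtain ⟨hunit, E0, E1, -, E3, hE2⟩ := h x.toKIdx c' 1 True hM₀ hN₀ hT₀ α₀ hα₀ hMα hKpl KB hKB' T A Q C ξ Λ hC hξ hΛ hΛξ hTS hQT hA hdA (collarS2Y x.toKIdx c') hα₁f
    hα₁ϱ hα4' hsmall hc₃ hsm hU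
  have hRf := hRt x.toKIdx c' 1 True hMR hNR hTR α₀ hα₀ hMα hKpl KB hKB' T A Q C ξ Λ hC hξ hΛ hΛξ hTS hQT hA hdA (collarS2Y x.toKIdx c') hα₁R hα₁ϱ hα4' hsmall
    hc₃ hsm hU
  have h261' : Ineq261 dB (toB6 (geoCK x.toKIdx c') 1 True) δ' (9 / 5000) := h261 x.toKIdx c' 1 True hN₁ (9 / 5000) le_rfl (by norm_num)
  have hdnn := (geoCK_dist_axioms x.toKIdx c' 1 True).1
  have hlen0 : ∀ a : BlkCubeY x.toKIdx c', 0 ≤ (geoCK x.toKIdx c').len a := fun a => (geoCK_len_pos x.toKIdx c' a).le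
  have hlen2 : ∀ a : BlkCubeY x.toKIdx c', 0 ≤ (geoCK x.toKIdx c').len a ^ 2 := fun a => sq_nonneg _
  have hBB : Bf ≤ B₂ + Bf := by linarith
  have hBB0 : 0 ≤ B₂ + Bf := by linarith
  -- the flat half at the joint rate
  have hRδ' : ∀ ν : Fin (d + 1), HasMajorant (g := toB6 (geoCK x.toKIdx c') 1 True) (blkBK x.toKIdx c')
      (GiK (trBasis N) x.toKIdx (TKnitCY x.toKIdx c' (cutCfgS x.toKIdx T (kGeo x.toKIdx).eta A)) (bondsOverY x.toKIdx (dirDomY x.toKIdx c')) *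
        conj (trBasis N) (cdsBₗ x.toKIdx (fun _ _ => (1 : (Matrix (Fin N) (Fin N) ℂ)ˣ)) ν))
      (fun a a' => B₂ * (geoCK x.toKIdx c').len a * Real.exp (-(δ' * (geoCK x.toKIdx c').dist a a'))) := fun ν =>
    hasMajorant_mono (g := toB6 (geoCK x.toKIdx c') 1 True) _ (hRf ν) fun a a' => kernel_rate_mono hdnn hδ'R (mul_nonneg hB₂ (hlen0 a)) a a'
  refine cubeRowsGDirCY_of_cutDatum x c' hu hTn hQT hgA 1 True h261' hunit ?_ ?_ ?_ ?_
  · exact hasMajorant_weaken x.toKIdx c' 1 True _ hlen2 hBB hBB0 hδ'δ E0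
  · exact fun ν => hasMajorant_weaken x.toKIdx c' 1 True _ hlen0 hBB hBB0 hδ'δ (E1 ν)
  · exact fun ν => hE2 ν B₂ δ' hB₂ hδ'.le hδ'δ (hRδ' ν)
  · refine hasMajorant_mono (g := toB6 (geoCK x.toKIdx c') 1 True) _ E3 fun a a' => ?_
    have hx : Real.exp (-(δ * (geoCK x.toKIdx c').dist a a')) ≤ Real.exp (-(δ' * (geoCK x.toKIdx c').dist a a')) :=
      Real.exp_le_exp.2 (by nlinarith [hdnn a a'])
    have hx1 : 0 ≤ Real.exp (-(δ' * (geoCK x.toKIdx c').dist a a')) := Real.exp_nonneg _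
    calc Bf * 1 * Real.exp (-(δ * (geoCK x.toKIdx c').dist a a')) = Bf * Real.exp (-(δ * (geoCK x.toKIdx c').dist a a')) := by rw [mul_one]
      _ ≤ Bf * Real.exp (-(δ' * (geoCK x.toKIdx c').dist a a')) := mul_le_mul_of_nonneg_left hx hBf
      _ ≤ (B₂ + Bf) * Real.exp (-(δ' * (geoCK x.toKIdx c').dist a a')) := mul_le_mul_of_nonneg_right hBB hx1

end Main

/-! ## §2  The hypothesis pack with the right-entry family and the universal block without the flat-half binder -/

section Pack

/-- **THE HYPOTHESIS PACK OF `cubeRowsGDirCY_at_memberR`** (dag-n06-d's ✓`GDirPackY` with the named fact read at the RIGHT-ENTRY family `GDirBFamR`): [4] Prop. 2.6 for the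
Dirichlet bond family BY NAME (NOT proved), `1 ≤ ℓ`, `0 < b₀ ≤ b₁`, and dag-n06-j's x-free knit-engine numerics at `(α₀′, ϱ′, ϱ)`.  A hypothesis pack (a `Prop` with
parameters), not a fact. [cite: Balaban1984PropagatorsII, Prop. 2.6 (2.136) p.247 (all four entries), p.248 l.4–5; Balaban1985BackgroundPropagators, Cor. 3.6 p.408, (3.83) p.407] -/
def GDirPackRY (d ℓ : ℕ) (hd : 1 ≤ d + 1) (hL : Odd (ℓ + 1) ∧ 1 < ℓ + 1) (b₀ b₁ : ℝ) (α₀' ϱ' ϱ : ℝ) : Prop :=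
  B6.Prop26DirichletPrinted (geoDirBI (d := d) (ℓ := ℓ) (hd := hd) (hL := hL) (b₀ := b₀) (b₁ := b₁)) domDirBI admDirBI GDirBFamR ∧
  1 ≤ ℓ ∧ 0 < b₀ ∧ b₀ ≤ b₁ ∧ 0 < α₀' ∧ C0 (d + 1) * α₀' ≤ 1 / 3 ∧ 8 * α₀' ≤ c2' (d + 1) (ℓ + 1) ∧ 0 < ϱ' ∧ 0 < ϱ ∧
  Real.exp (4 * (800 * (((d + 1 : ℕ) : ℝ) + 1) ^ 2 * (((d + 1 : ℕ) : ℝ) + 4)) * α₀') * (1 + 8 * (131072 * (((d + 1 : ℕ) : ℝ) + 1) ^ 2) * ϱ') ≤ 2 ∧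
  2 * ϱ' ≤ c3 (d + 1) (ℓ + 1) ∧ 409600 * (((d + 1 : ℕ) : ℝ) + 1) ^ 2 * ϱ' ≤ 1 ∧ epsCplx (d + 1) (ℓ + 1) ϱ' 0 ≤ 1 / 16 ∧
  ((d + 1 : ℕ) : ℝ) * (epsCplx (d + 1) (ℓ + 1) ϱ' 0 + tauCplx (d + 1) (ℓ + 1) α₀' 0 ϱ' 0) ≤ 1 / 16 ∧
  Real.exp (4480 * (((d + 1 : ℕ) : ℝ) + 1) ^ 2 * (((d + 1 : ℕ) : ℝ) + 4) * α₀' + 240000 * (((d + 1 : ℕ) : ℝ) + 1) ^ 3 * ϱ') *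
      (1 + 8 * (2097152 * (((d + 1 : ℕ) : ℝ) + 1) ^ 2) * ϱ) ≤ 2 ∧
  2 * ϱ ≤ c3 (d + 1) (ℓ + 1) / 4

/-- the old pack follows from the new one (R1 ✓`prop26Dirichlet_of_right`): every consumer of ✓`GDirPackY` is served by `GDirPackRY`.
[cite: Balaban1984PropagatorsII, Prop. 2.6 (2.136) p.247, p.248 l.4–5, bookkeeping] -/
theorem gdirPackY_of_packR {α₀' ϱ' ϱ : ℝ} (h : GDirPackRY d ℓ hd hL b₀ b₁ α₀' ϱ' ϱ) :
    B9CubeDirInverseBondCRowsNamedY.GDirPackY d ℓ hd hL b₀ b₁ α₀' ϱ' ϱ :=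
  ⟨prop26Dirichlet_of_right h.1, h.2⟩

/-- **THE UNIVERSAL BLOCK OF `cubeRowsGDirCY_at_memberR` AT GIVEN CONSTANTS `(δ, B, M₀, T₀, N₀, d_B, a₁)`** (dag-n06-d's ✓`RowsBodyY` WITHOUT the `B₂` ∕ flat-right-half
binders): for every member above the thresholds, every auxiliary `α₀ > 0` with `K_pl(Mα₀)L⁴ < α₀′`, every unitary-valued `U` with a bond socket and the bond datum at
`a₁` at every cube: the bundle `CubeRowsGDirCY x.toKIdx □ U d_B B δ (9∕5000)` at every `□`.  A hypothesis-shaped `Prop` with parameters, not a fact.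
[cite: Balaban1985BackgroundPropagators, Cor. 3.6 p.408 l.1–14, Thm 3.1 (3.42) p.397, (3.35) p.396; Balaban1984PropagatorsII, Lemma 2.1 (2.61) p.234] -/
def RowsBodyRY (N : ℕ) [Nonempty (Fin N)] (d ℓ : ℕ) (hd : 1 ≤ d + 1) (hL : Odd (ℓ + 1) ∧ 1 < ℓ + 1) (b₀ b₁ : ℝ) (Mstar : ℕ) (α₀' ϱ' : ℝ)
    (δ B M₀ T₀ : ℝ) (N₀ dB : ℕ) (a₁ : ℝ) : Prop :=
  ∀ (x : MemberY d ℓ hd hL b₀ b₁ Mstar),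
    M₀ ≤ ((ℓ : ℝ) + 1) * (toKT x.toKIdx).Mh → N₀ + 1 ≤ (toKT x.toKIdx).R * ((ℓ + 1) * (toKT x.toKIdx).Mh) → T₀ ≤ RM1 x.toKIdx →
  ∀ α₀ : ℝ, 0 < α₀ → 0 ≤ (kGeo x.toKIdx).M * α₀ → Kpl x.toKIdx ((kGeo x.toKIdx).M * α₀) * (kGeo x.toKIdx).L ^ 4 < α₀' →
  ∀ (U : CfgY (Matrix (Fin N) (Fin N) ℂ) x.toKIdx), (∀ μ z, U μ z ∈ unitaryUnits (Matrix (Fin N) (Fin N) ℂ)) →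
    (∀ c' : ↥(cubes x.toKIdx.D.toDomains), ∃ KB : Matrix (FBondY x.toKIdx) (FBondY x.toKIdx) ℝ,
      (mDirC x.toKIdx c').submatrix (fun v : ↥(bondsOverY x.toKIdx (dirDomY x.toKIdx c')) => (v : FBondY x.toKIdx))
          (fun v : ↥(bondsOverY x.toKIdx (dirDomY x.toKIdx c')) => (v : FBondY x.toKIdx)) *
        KB.submatrix (fun v : ↥(bondsOverY x.toKIdx (dirDomY x.toKIdx c')) => (v : FBondY x.toKIdx))
          (fun v : ↥(bondsOverY x.toKIdx (dirDomY x.toKIdx c')) => (v : FBondY x.toKIdx)) = 1) →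
    (∀ c' : ↥(cubes x.toKIdx.D.toDomains), DatumBUY x.toKIdx c' U a₁ α₀' ϱ') →
    ∀ c' : ↥(cubes x.toKIdx.D.toDomains), CubeRowsGDirCY x.toKIdx c' U dB B δ (9 / 5000)

/-- `cubeRowsGDirCY_at_memberR` RE-KEYED ON THE PACK: under `GDirPackRY` there are constants with `RowsBodyRY`.
[cite: Balaban1985BackgroundPropagators, Cor. 3.6 p.408 l.1–14; Balaban1984PropagatorsII, Prop. 2.6 (2.136) p.247] -/
theorem rowsBodyRY_of_packR (N : ℕ) [Nonempty (Fin N)] (d ℓ : ℕ) (hd : 1 ≤ d + 1) (hL : Odd (ℓ + 1) ∧ 1 < ℓ + 1) (b₀ b₁ : ℝ) (Mstar : ℕ) (α₀' ϱ' ϱ : ℝ)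
    (h : GDirPackRY d ℓ hd hL b₀ b₁ α₀' ϱ' ϱ) :
    ∃ δ B M₀ T₀ : ℝ, ∃ N₀ dB : ℕ, 0 < δ ∧ 0 ≤ B ∧ ∃ a₁ : ℝ, 0 < a₁ ∧ RowsBodyRY N d ℓ hd hL b₀ b₁ Mstar α₀' ϱ' δ B M₀ T₀ N₀ dB a₁ := by
  obtain ⟨h26R, hℓ, hb₀, hb₁, hα', hα3, hα8, hϱ', hϱ, hsmall', hc₃', hϱ'1, hE, hdX, hsmallJ, hc₃J⟩ := h
  exact cubeRowsGDirCY_at_memberR (N := N) (Mstar := Mstar) h26R hℓ hb₀ hb₁ hα' hα3 hα8 hϱ' hϱ hsmall' hc₃' hϱ'1 hE hdX hsmallJ hc₃J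

end Pack

/-! ## §3  The names, the rows at the names, the sign facts (dag-n06-d's ✓`B9CubeDirInverseBondCRowsNamedY` format) -/

section Names

open Classical in
/-- **the uniform decay rate `δ` of the bundle, NAMED** (default `1` outside the pack). [cite: Balaban1985BackgroundPropagators, Thm 3.3 p.399, Cor. 3.6 p.408] -/
def gdirRδ (N : ℕ) [Nonempty (Fin N)] (d ℓ : ℕ) (hd : 1 ≤ d + 1) (hL : Odd (ℓ + 1) ∧ 1 < ℓ + 1) (b₀ b₁ : ℝ) (Mstar : ℕ) (α₀' ϱ' ϱ : ℝ) : ℝ :=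
  if h : GDirPackRY d ℓ hd hL b₀ b₁ α₀' ϱ' ϱ then (rowsBodyRY_of_packR N d ℓ hd hL b₀ b₁ Mstar α₀' ϱ' ϱ h).choose else 1

open Classical in
/-- **the uniform entry constant `B` of the bundle (all four entries), NAMED** (default `0`). [cite: Balaban1985BackgroundPropagators, Thm 3.1 (3.42) p.397, Cor. 3.6 p.408] -/
def gdirRB (N : ℕ) [Nonempty (Fin N)] (d ℓ : ℕ) (hd : 1 ≤ d + 1) (hL : Odd (ℓ + 1) ∧ 1 < ℓ + 1) (b₀ b₁ : ℝ) (Mstar : ℕ) (α₀' ϱ' ϱ : ℝ) : ℝ :=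
  if h : GDirPackRY d ℓ hd hL b₀ b₁ α₀' ϱ' ϱ then (rowsBodyRY_of_packR N d ℓ hd hL b₀ b₁ Mstar α₀' ϱ' ϱ h).choose_spec.choose else 0

open Classical in
/-- **the member threshold `M₀` (`M₀ ≤ L·M_h`), NAMED** (default `0`). [cite: Balaban1985BackgroundPropagators, Thm 3.3 p.399 («M sufficiently large»)] -/
def gdirRM₀ (N : ℕ) [Nonempty (Fin N)] (d ℓ : ℕ) (hd : 1 ≤ d + 1) (hL : Odd (ℓ + 1) ∧ 1 < ℓ + 1) (b₀ b₁ : ℝ) (Mstar : ℕ) (α₀' ϱ' ϱ : ℝ) : ℝ :=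
  if h : GDirPackRY d ℓ hd hL b₀ b₁ α₀' ϱ' ϱ then (rowsBodyRY_of_packR N d ℓ hd hL b₀ b₁ Mstar α₀' ϱ' ϱ h).choose_spec.choose_spec.choose else 0

open Classical in
/-- **the level-run threshold `T₀` (`T₀ ≤ R_{M,1}`), NAMED** (default `0`). [cite: Balaban1984PropagatorsII, (2.2) p.224; Balaban1985BackgroundPropagators, Cor. 3.6 p.408] -/
def gdirRT₀ (N : ℕ) [Nonempty (Fin N)] (d ℓ : ℕ) (hd : 1 ≤ d + 1) (hL : Odd (ℓ + 1) ∧ 1 < ℓ + 1) (b₀ b₁ : ℝ) (Mstar : ℕ) (α₀' ϱ' ϱ : ℝ) : ℝ :=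
  if h : GDirPackRY d ℓ hd hL b₀ b₁ α₀' ϱ' ϱ then (rowsBodyRY_of_packR N d ℓ hd hL b₀ b₁ Mstar α₀' ϱ' ϱ h).choose_spec.choose_spec.choose_spec.choose else 0

open Classical in
/-- **the band threshold `N₀` (`N₀ + 1 ≤ R·L·M_h`), NAMED** (default `0`). [cite: Balaban1984PropagatorsII, (2.2) p.224, Lemma 2.1 (2.61) p.234] -/
def gdirRN₀ (N : ℕ) [Nonempty (Fin N)] (d ℓ : ℕ) (hd : 1 ≤ d + 1) (hL : Odd (ℓ + 1) ∧ 1 < ℓ + 1) (b₀ b₁ : ℝ) (Mstar : ℕ) (α₀' ϱ' ϱ : ℝ) : ℕ :=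
  if h : GDirPackRY d ℓ hd hL b₀ b₁ α₀' ϱ' ϱ then (rowsBodyRY_of_packR N d ℓ hd hL b₀ b₁ Mstar α₀' ϱ' ϱ h).choose_spec.choose_spec.choose_spec.choose_spec.choose
  else 0

open Classical in
/-- **the (2.61) splitting exponent `d_B`, NAMED** (default `0`). [cite: Balaban1984PropagatorsII, Lemma 2.1 (2.61) p.234] -/
def gdirRdB (N : ℕ) [Nonempty (Fin N)] (d ℓ : ℕ) (hd : 1 ≤ d + 1) (hL : Odd (ℓ + 1) ∧ 1 < ℓ + 1) (b₀ b₁ : ℝ) (Mstar : ℕ) (α₀' ϱ' ϱ : ℝ) : ℕ :=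
  if h : GDirPackRY d ℓ hd hL b₀ b₁ α₀' ϱ' ϱ then
    (rowsBodyRY_of_packR N d ℓ hd hL b₀ b₁ Mstar α₀' ϱ' ϱ h).choose_spec.choose_spec.choose_spec.choose_spec.choose_spec.choose
  else 0

open Classical in
/-- **the smallness threshold `a₁` of the bond datum (`2CΛ² ≤ a₁`), NAMED** (default `1`). [cite: Balaban1985BackgroundPropagators, (3.35) p.396, Cor. 3.6 p.408] -/
def gdirRa₁ (N : ℕ) [Nonempty (Fin N)] (d ℓ : ℕ) (hd : 1 ≤ d + 1) (hL : Odd (ℓ + 1) ∧ 1 < ℓ + 1) (b₀ b₁ : ℝ) (Mstar : ℕ) (α₀' ϱ' ϱ : ℝ) : ℝ :=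
  if h : GDirPackRY d ℓ hd hL b₀ b₁ α₀' ϱ' ϱ then
    (rowsBodyRY_of_packR N d ℓ hd hL b₀ b₁ Mstar α₀' ϱ' ϱ h).choose_spec.choose_spec.choose_spec.choose_spec.choose_spec.choose_spec.2.2.choose
  else 1

/-- ★★ **THE UNIFORM THEOREM AT THE NAMES**: under the pack, `0 < gdirRδ`, `0 ≤ gdirRB`, `0 < gdirRa₁` and the universal block `RowsBodyRY` at the seven named constants.
[cite: Balaban1985BackgroundPropagators, Cor. 3.6 p.408 l.1–14, Thm 3.3 p.399, Thm 3.1 (3.42) p.397; Balaban1984PropagatorsII, Prop. 2.6 (2.136) p.247, Lemma 2.1 (2.61) p.234] -/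
theorem gdirR_rows_of_packR (N : ℕ) [Nonempty (Fin N)] (d ℓ : ℕ) (hd : 1 ≤ d + 1) (hL : Odd (ℓ + 1) ∧ 1 < ℓ + 1) (b₀ b₁ : ℝ) (Mstar : ℕ) (α₀' ϱ' ϱ : ℝ)
    (h : GDirPackRY d ℓ hd hL b₀ b₁ α₀' ϱ' ϱ) :
    0 < gdirRδ N d ℓ hd hL b₀ b₁ Mstar α₀' ϱ' ϱ ∧ 0 ≤ gdirRB N d ℓ hd hL b₀ b₁ Mstar α₀' ϱ' ϱ ∧ 0 < gdirRa₁ N d ℓ hd hL b₀ b₁ Mstar α₀' ϱ' ϱ ∧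
      RowsBodyRY N d ℓ hd hL b₀ b₁ Mstar α₀' ϱ' (gdirRδ N d ℓ hd hL b₀ b₁ Mstar α₀' ϱ' ϱ) (gdirRB N d ℓ hd hL b₀ b₁ Mstar α₀' ϱ' ϱ)
        (gdirRM₀ N d ℓ hd hL b₀ b₁ Mstar α₀' ϱ' ϱ) (gdirRT₀ N d ℓ hd hL b₀ b₁ Mstar α₀' ϱ' ϱ) (gdirRN₀ N d ℓ hd hL b₀ b₁ Mstar α₀' ϱ' ϱ)
        (gdirRdB N d ℓ hd hL b₀ b₁ Mstar α₀' ϱ' ϱ) (gdirRa₁ N d ℓ hd hL b₀ b₁ Mstar α₀' ϱ' ϱ) := by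
  have H := (rowsBodyRY_of_packR N d ℓ hd hL b₀ b₁ Mstar α₀' ϱ' ϱ h).choose_spec.choose_spec.choose_spec.choose_spec.choose_spec.choose_spec
  simp only [gdirRδ, gdirRB, gdirRM₀, gdirRT₀, gdirRN₀, gdirRdB, gdirRa₁, dif_pos h]
  exact ⟨H.1, H.2.1, H.2.2.choose_spec.1, H.2.2.choose_spec.2⟩

/-- `0 < gdirRδ` unconditionally. [cite: Balaban1985BackgroundPropagators, Thm 3.3 p.399, bookkeeping] -/
theorem gdirRδ_pos (N : ℕ) [Nonempty (Fin N)] (d ℓ : ℕ) (hd : 1 ≤ d + 1) (hL : Odd (ℓ + 1) ∧ 1 < ℓ + 1) (b₀ b₁ : ℝ) (Mstar : ℕ) (α₀' ϱ' ϱ : ℝ) :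
    0 < gdirRδ N d ℓ hd hL b₀ b₁ Mstar α₀' ϱ' ϱ := by
  by_cases h : GDirPackRY d ℓ hd hL b₀ b₁ α₀' ϱ' ϱ
  · exact (gdirR_rows_of_packR N d ℓ hd hL b₀ b₁ Mstar α₀' ϱ' ϱ h).1
  · rw [gdirRδ, dif_neg h]; exact one_pos

/-- `0 ≤ gdirRB` unconditionally. [cite: Balaban1985BackgroundPropagators, Thm 3.1 (3.42) p.397, bookkeeping] -/
theorem gdirRB_nonneg (N : ℕ) [Nonempty (Fin N)] (d ℓ : ℕ) (hd : 1 ≤ d + 1) (hL : Odd (ℓ + 1) ∧ 1 < ℓ + 1) (b₀ b₁ : ℝ) (Mstar : ℕ) (α₀' ϱ' ϱ : ℝ) :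
    0 ≤ gdirRB N d ℓ hd hL b₀ b₁ Mstar α₀' ϱ' ϱ := by
  by_cases h : GDirPackRY d ℓ hd hL b₀ b₁ α₀' ϱ' ϱ
  · exact (gdirR_rows_of_packR N d ℓ hd hL b₀ b₁ Mstar α₀' ϱ' ϱ h).2.1
  · rw [gdirRB, dif_neg h]

/-- `0 < gdirRa₁` unconditionally. [cite: Balaban1985BackgroundPropagators, (3.35) p.396, bookkeeping] -/
theorem gdirRa₁_pos (N : ℕ) [Nonempty (Fin N)] (d ℓ : ℕ) (hd : 1 ≤ d + 1) (hL : Odd (ℓ + 1) ∧ 1 < ℓ + 1) (b₀ b₁ : ℝ) (Mstar : ℕ) (α₀' ϱ' ϱ : ℝ) :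
    0 < gdirRa₁ N d ℓ hd hL b₀ b₁ Mstar α₀' ϱ' ϱ := by
  by_cases h : GDirPackRY d ℓ hd hL b₀ b₁ α₀' ϱ' ϱ
  · exact (gdirR_rows_of_packR N d ℓ hd hL b₀ b₁ Mstar α₀' ϱ' ϱ h).2.2.1
  · rw [gdirRa₁, dif_neg h]; exact one_pos

/-- ★ **THE BUNDLE AT ONE MEMBER, ONE AUXILIARY `α₀`, ONE UNITARY-VALUED `U`, EVERY CUBE — HEADS' BINDER ORDER** (dag-n06-d's ✓`cubeRowsGDirCY_named` without `B₂`, `hB₂`,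
`hR`): the two displayed rows (socket, bond datum at `gdirRa₁`), the pack and the three named thresholds give `CubeRowsGDirCY x.toKIdx □ U gdirRdB gdirRB gdirRδ (9∕5000)`.
[cite: Balaban1985BackgroundPropagators, Cor. 3.6 p.408 l.1–14, Thm 3.1 (3.42) p.397, (3.35) p.396, p.409 l.1–5] -/
theorem cubeRowsGDirCY_namedR {N : ℕ} [Nonempty (Fin N)] {d ℓ : ℕ} {hd : 1 ≤ d + 1} {hL : Odd (ℓ + 1) ∧ 1 < ℓ + 1} {b₀ b₁ : ℝ} {Mstar : ℕ} {α₀' ϱ' ϱ : ℝ}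
    (h : GDirPackRY d ℓ hd hL b₀ b₁ α₀' ϱ' ϱ) (x : MemberY d ℓ hd hL b₀ b₁ Mstar)
    (hM : gdirRM₀ N d ℓ hd hL b₀ b₁ Mstar α₀' ϱ' ϱ ≤ ((ℓ : ℝ) + 1) * (toKT x.toKIdx).Mh)
    (hN : gdirRN₀ N d ℓ hd hL b₀ b₁ Mstar α₀' ϱ' ϱ + 1 ≤ (toKT x.toKIdx).R * ((ℓ + 1) * (toKT x.toKIdx).Mh))
    (hT : gdirRT₀ N d ℓ hd hL b₀ b₁ Mstar α₀' ϱ' ϱ ≤ RM1 x.toKIdx)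
    {α₀ : ℝ} (hα₀ : 0 < α₀) (hMα : 0 ≤ (kGeo x.toKIdx).M * α₀) (hKpl : Kpl x.toKIdx ((kGeo x.toKIdx).M * α₀) * (kGeo x.toKIdx).L ^ 4 < α₀')
    (U : CfgY (Matrix (Fin N) (Fin N) ℂ) x.toKIdx) (hUu : ∀ μ z, U μ z ∈ unitaryUnits (Matrix (Fin N) (Fin N) ℂ))
    (hKB : ∀ c' : ↥(cubes x.toKIdx.D.toDomains), ∃ KB : Matrix (FBondY x.toKIdx) (FBondY x.toKIdx) ℝ,
      (mDirC x.toKIdx c').submatrix (fun v : ↥(bondsOverY x.toKIdx (dirDomY x.toKIdx c')) => (v : FBondY x.toKIdx))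
          (fun v : ↥(bondsOverY x.toKIdx (dirDomY x.toKIdx c')) => (v : FBondY x.toKIdx)) *
        KB.submatrix (fun v : ↥(bondsOverY x.toKIdx (dirDomY x.toKIdx c')) => (v : FBondY x.toKIdx))
          (fun v : ↥(bondsOverY x.toKIdx (dirDomY x.toKIdx c')) => (v : FBondY x.toKIdx)) = 1)
    (hDat : ∀ c' : ↥(cubes x.toKIdx.D.toDomains), DatumBUY x.toKIdx c' U (gdirRa₁ N d ℓ hd hL b₀ b₁ Mstar α₀' ϱ' ϱ) α₀' ϱ')
    (c' : ↥(cubes x.toKIdx.D.toDomains)) :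
    CubeRowsGDirCY x.toKIdx c' U (gdirRdB N d ℓ hd hL b₀ b₁ Mstar α₀' ϱ' ϱ) (gdirRB N d ℓ hd hL b₀ b₁ Mstar α₀' ϱ' ϱ)
      (gdirRδ N d ℓ hd hL b₀ b₁ Mstar α₀' ϱ' ϱ) (9 / 5000) :=
  (gdirR_rows_of_packR N d ℓ hd hL b₀ b₁ Mstar α₀' ϱ' ϱ h).2.2.2 x hM hN hT α₀ hα₀ hMα hKpl U hUu hKB hDat c'

end Names

end Literature.MathematicalPhysics.QuantumFieldTheory.Balaban1983to89.B9Cor36GDirKnitRowsAtMemberRY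

end
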